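import Literature.Combinatorics.SetFamily.FranklWilsonTheorem

/-!
# The Ray-Chaudhuri–Wilson theorem: a `k`-uniform `L`-intersecting family has at most `C(n, |L|)`
# members (Ray-Chaudhuri–Wilson 1975; proof of Alon–Babai–Suzuki 1991)

S. Jukna, *Extremal Combinatorics — with applications in computer science* (1st ed., Springer 2001)
[Jukna2001], Chapter 14 "The basic method", §14.3.2 ("the celebrated result of Ray-Chaudhuri and
Wilson (1975) gives the upper bound `|𝓕| ≤ C(n, |L|)`") and Exercise 14.22 with
the printed proof sketch of Alon–Babai–Suzuki (1991); originals: D. K. Ray-Chaudhuri, R. M. Wilson,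
*On `t`-designs*, Osaka J. Math. 12 (1975) 737–744 [RayChaudhuriWilson1975]; N. Alon, L. Babai,
H. Suzuki, J. Combin. Theory Ser. A 58 (1991) 165–180 [AlonBabaiSuzuki1991].

**Exercise 14.22 (Ray-Chaudhuri–Wilson 1975).** If `A_1, …, A_m` is a `k`-uniform `L`-intersecting
family of subsets of an `n`-element set, then `m ≤ C(n, s)`, where `s = |L|` (with, as usual, the
members of `L` below `k` — an intersection size of two distinct `k`-sets is `< k`).

Printed sketch (Alon–Babai–Suzuki): with the polynomials `f_i = ∏_{l ∈ L} (⟨v_i, x⟩ − l)` of the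
proof of Theorem 14.13 and, for `|I| ≤ s − 1`, `g_I(x) = ((Σ_j x_j) − k) ∏_{i ∈ I} x_i`, one has
`g_I(S) ≠ 0` iff `|S| ≠ k` and `S ⊇ I`; substituting the `A_j` kills the `λ_j`, and a relation
among the `g_I` alone is impossible (look at an extremal `I`); all these polynomials are
multilinear of degree `≤ s`, so `m + Σ_{i<s} C(n,i) ≤ Σ_{i≤s} C(n,i)`.

PROVED here (theorems only, no named facts), on `{0,1}^n = Finset α` with functions
`Finset α → ℝ` as in `FranklWilsonTheorem` (whose Lemma 14.11 `linearIndependent_of_triangular_eval`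
and span lemmas `babaiFun_mem_span`, `linearFactor_mul_mem_span` are reused):
* `card_subsets_card_lt` — `|{I : |I| < s}| = Σ_{i<s} C(n,i)`;
* `card_monomials_le` — there are at most `Σ_{i≤d} C(n,i)` monomials `χ_S`, `|S| ≤ d`;
* `linearIndependent_absFun` — the `f_A` (`A ∈ 𝓕`) together with the `g_I` (`|I| < s`) are
  linearly independent (Lemma 14.11 with the ranking `A ↦ 0`, `I ↦ |I| + 1`);
* **`ray_chaudhuri_wilson`** — the theorem: `k`-uniform, `|A ∩ B| ∈ L` for distinct members,
  every `l ∈ L` below `k` ⇒ `|𝓕| ≤ C(n, |L|)`;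
* `ray_chaudhuri_wilson_filter` — without the hypothesis on `L`: `|𝓕| ≤ C(n, |{l ∈ L : l < k}|)`.

## References

* [Jukna2001] S. Jukna, *Extremal Combinatorics*, 1st ed., Springer (2001), §14.3.2 and
  Exercise 14.22 (held text `book:jukna2011-extremal-combinatorics-with-applications-computer-science`,
  chunks 177, 188).
* [RayChaudhuriWilson1975] D. K. Ray-Chaudhuri, R. M. Wilson, Osaka J. Math. 12 (1975) 737–744.
* [AlonBabaiSuzuki1991] N. Alon, L. Babai, H. Suzuki, J. Combin. Theory Ser. A 58 (1991) 165–180.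
-/

namespace Literature.Combinatorics.SetFamily

open Finset

variable {α : Type*} [DecidableEq α]

/-! ### Counting -/

/-- The number of subsets of size `< s` of an `n`-set is `Σ_{i<s} C(n,i)`.
[cite: Jukna2001, Ch. 14 Exercise 14.22 (the polynomials `g_I`, `|I| ≤ s − 1`)] -/
theorem card_subsets_card_lt [Fintype α] (s : ℕ) :
    Fintype.card {I : Finset α // I.card < s} =
      ∑ i ∈ Finset.range s, (Fintype.card α).choose i := by
  classical
  rw [Fintype.card_subtype]
  have hdecomp : (Finset.univ : Finset (Finset α)).filter (fun A => A.card < s) =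
      (Finset.range s).biUnion (fun i => Finset.powersetCard i Finset.univ) := by
    ext A
    simp only [Finset.mem_filter, Finset.mem_univ, true_and, Finset.mem_biUnion, Finset.mem_range,
      Finset.mem_powersetCard, Finset.subset_univ]
    constructor
    · intro h; exact ⟨A.card, h, rfl⟩
    · rintro ⟨i, hi, rfl⟩; exact hi
  rw [hdecomp, Finset.card_biUnion]
  · exact Finset.sum_congr rfl fun i _ => by rw [Finset.card_powersetCard, Finset.card_univ]
  · intro i _ j _ hij
    rw [Function.onFun, Finset.disjoint_left]
    intro A hAi hAj
    rw [Finset.mem_powersetCard] at hAi hAj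
    exact hij (hAi.2.symm.trans hAj.2)

/-- There are at most `Σ_{i ≤ d} C(n,i)` monomial functions `χ_S`, `|S| ≤ d`.
[cite: Jukna2001, Ch. 14 §14.3, proof of Theorem 14.13 ("we have only `Σ_{i=0}^s C(n,i)` of
them")] -/
theorem card_monomials_le [Fintype α] (d : ℕ) :
    (((Finset.univ : Finset (Finset α)).filter (fun S => S.card ≤ d)).image
        (fun S => fun B : Finset α => if S ⊆ B then (1 : ℝ) else 0)).card ≤
      ∑ i ∈ Finset.range (d + 1), (Fintype.card α).choose i := by
  classical
  refine Finset.card_image_le.trans ?_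
  have hdecomp : (Finset.univ : Finset (Finset α)).filter (fun S => S.card ≤ d) =
      (Finset.range (d + 1)).biUnion (fun i => Finset.powersetCard i Finset.univ) := by
    ext S
    simp only [Finset.mem_filter, Finset.mem_univ, true_and, Finset.mem_biUnion, Finset.mem_range,
      Finset.mem_powersetCard, Finset.subset_univ]
    constructor
    · intro h; exact ⟨S.card, Nat.lt_succ_of_le h, rfl⟩
    · rintro ⟨i, hi, rfl⟩; omega
  rw [hdecomp]
  refine Finset.card_biUnion_le.trans (Finset.sum_le_sum fun i _ => ?_)
  rw [Finset.card_powersetCard, Finset.card_univ]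

/-! ### Linear independence of the Alon–Babai–Suzuki family -/

/-- **The Alon–Babai–Suzuki family is linearly independent.** For a `k`-uniform family `𝓕` with
`|A ∩ B| ∈ L` for distinct members and every `l ∈ L` below `k`, the functions
`f_A(B) = ∏_{l∈L} (|A ∩ B| − l)` (`A ∈ 𝓕`) together with `g_I(B) = (|B| − k)·[I ⊆ B]` (`|I| < s`,
`s ≤ k`) are linearly independent: `f_A(A) ≠ 0`, `f_A(B) = 0` (`B ≠ A`), `g_I(A) = 0` (`|A| = k`),
`g_I(I) ≠ 0`, `g_J(I) = 0` unless `J ⊆ I` — Lemma 14.11 with the ranking `A ↦ 0`, `I ↦ |I| + 1`.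
[cite: Jukna2001, Ch. 14 Exercise 14.22 (sketch); AlonBabaiSuzuki1991] -/
theorem linearIndependent_absFun [Fintype α] (L : Finset ℕ) (k s : ℕ) (𝓕 : Finset (Finset α))
    (hk : ∀ A ∈ 𝓕, A.card = k) (hLk : ∀ l ∈ L, l < k) (hs : s ≤ k)
    (hL : ∀ A ∈ 𝓕, ∀ B ∈ 𝓕, A ≠ B → (A ∩ B).card ∈ L) :
    LinearIndependent ℝ
      (Sum.elim
        (fun (A : 𝓕) (B : Finset α) => ∏ l ∈ L, ((((A : Finset α) ∩ B).card : ℝ) - l))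
        (fun (I : {I : Finset α // I.card < s}) (B : Finset α) =>
          ((((Finset.univ : Finset α) ∩ B).card : ℝ) - k) * (if I.1 ⊆ B then 1 else 0)) :
        𝓕 ⊕ {I : Finset α // I.card < s} → Finset α → ℝ) := by
  classical
  refine linearIndependent_of_triangular_eval _
    (Sum.elim (fun A => (A : Finset α)) (fun I => I.1))
    (Sum.elim (fun _ => 0) (fun I => I.1.card + 1)) ?_ ?_
  · -- (a): diagonal values are nonzero
    rintro (A | I)
    · simp only [Sum.elim_inl, Finset.inter_self, hk _ A.2]
      rw [Finset.prod_ne_zero_iff]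
      intro l hl
      exact sub_ne_zero.mpr (by exact_mod_cast (hLk l hl).ne')
    · simp only [Sum.elim_inr, Finset.univ_inter, Finset.Subset.refl, if_true, mul_one]
      exact sub_ne_zero.mpr (by exact_mod_cast (I.2.trans_le hs).ne)
  · -- (b): below-diagonal values vanish
    rintro (A | I) (A' | J) hne hr
    · -- `f_{A'}(A) = 0`
      simp only [Sum.elim_inl]
      have hne' : (A' : Finset α) ≠ (A : Finset α) := fun h => hne (by rw [Subtype.ext h])
      exact Finset.prod_eq_zero (hL _ A'.2 _ A.2 hne') (by rw [sub_self])
    · -- `g_J(A) = 0` since `|A| = k`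
      simp only [Sum.elim_inl, Sum.elim_inr, Finset.univ_inter, hk _ A.2, sub_self, zero_mul]
    · -- no condition: the ranking puts `I` after every `A'`
      simp only [Sum.elim_inr, Sum.elim_inl] at hr
      omega
    · -- `g_J(I) = 0`: `J ⊆ I` with `|J| ≥ |I|` would force `J = I`
      simp only [Sum.elim_inr] at hr ⊢
      rw [if_neg, mul_zero]
      intro hJI
      have hJI' : J.1 = I.1 := Finset.eq_of_subset_of_card_le hJI (by omega)
      exact hne (by rw [Subtype.ext hJI'])

/-! ### The theorem -/

/-- **The Ray-Chaudhuri–Wilson theorem (1975; proof of Alon–Babai–Suzuki 1991).** Let `𝓕` be a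
`k`-uniform family of subsets of an `n`-set such that `|A ∩ B| ∈ L` for all distinct `A, B ∈ 𝓕`,
where every member of `L` is less than `k`. Then `|𝓕| ≤ C(n, |L|)`.
[cite: Jukna2001, Ch. 14 §14.3.2 and Exercise 14.22; RayChaudhuriWilson1975;
AlonBabaiSuzuki1991] -/
theorem ray_chaudhuri_wilson [Fintype α] (L : Finset ℕ) (k : ℕ) (𝓕 : Finset (Finset α))
    (hk : ∀ A ∈ 𝓕, A.card = k) (hLk : ∀ l ∈ L, l < k)
    (hL : ∀ A ∈ 𝓕, ∀ B ∈ 𝓕, A ≠ B → (A ∩ B).card ∈ L) :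
    𝓕.card ≤ (Fintype.card α).choose L.card := by
  classical
  set s := L.card with hs_def
  have hs : s ≤ k := by
    have h := Finset.card_le_card (show L ⊆ Finset.range k from fun l hl =>
      Finset.mem_range.mpr (hLk l hl))
    rwa [Finset.card_range] at h
  have hli := linearIndependent_absFun L k s 𝓕 hk hLk hs hL
  -- everything lies in the span of the monomials of degree `≤ s`
  set T := ((Finset.univ : Finset (Finset α)).filter (fun S => S.card ≤ s)).image
      (fun S => fun B : Finset α => if S ⊆ B then (1 : ℝ) else 0) with hT
  have hmono : ∀ d ≤ s, Submodule.span ℝ ((((Finset.univ : Finset (Finset α)).filter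
      (fun S => S.card ≤ d)).image
        (fun S => fun B : Finset α => if S ⊆ B then (1 : ℝ) else 0) : Finset (Finset α → ℝ)) :
          Set (Finset α → ℝ)) ≤ Submodule.span ℝ (T : Set (Finset α → ℝ)) := by
    intro d hd
    apply Submodule.span_mono
    intro g hg
    simp only [hT, Finset.coe_image, Finset.coe_filter, Finset.mem_univ, true_and, Set.mem_image,
      Set.mem_setOf_eq] at hg ⊢
    obtain ⟨S, hS, rfl⟩ := hg
    exact ⟨S, hS.trans hd, rfl⟩
  have hspan : Set.range (Sum.elim
      (fun (A : 𝓕) (B : Finset α) => ∏ l ∈ L, ((((A : Finset α) ∩ B).card : ℝ) - l))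
      (fun (I : {I : Finset α // I.card < s}) (B : Finset α) =>
        ((((Finset.univ : Finset α) ∩ B).card : ℝ) - k) * (if I.1 ⊆ B then 1 else 0))) ≤
      Submodule.span ℝ (T : Set (Finset α → ℝ)) := by
    rintro g ⟨i, rfl⟩
    rcases i with A | I
    · -- `f_A`: by `babaiFun_mem_span`, degree `≤ |L| = s`
      exact hmono L.card le_rfl (babaiFun_mem_span (A : Finset α) L)
    · -- `g_I = (|B| − k) · χ_I`: degree `≤ |I| + 1 ≤ s`
      have hχ : (fun B : Finset α => if I.1 ⊆ B then (1 : ℝ) else 0) ∈ Submodule.span ℝ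
          ((((Finset.univ : Finset (Finset α)).filter (fun S => S.card ≤ I.1.card)).image
            (fun S => fun B : Finset α => if S ⊆ B then (1 : ℝ) else 0) : Finset (Finset α → ℝ)) :
              Set (Finset α → ℝ)) := by
        apply Submodule.subset_span
        simp only [Finset.coe_image, Finset.coe_filter, Finset.mem_univ, true_and, Set.mem_image,
          Set.mem_setOf_eq]
        exact ⟨I.1, le_rfl, rfl⟩
      have h := linearFactor_mul_mem_span (Finset.univ : Finset α) (k : ℝ) I.1.card _ hχ
      exact hmono (I.1.card + 1) (by have := I.2; omega) h
  -- the linear algebra bound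
  have hcard := linearIndependent_le_span_aux' _ hli (T : Set (Finset α → ℝ)) hspan
  simp only [Fintype.card_sum, Fintype.card_coe, Finset.coe_sort_coe] at hcard
  rw [card_subsets_card_lt] at hcard
  have hT' := card_monomials_le (α := α) s
  rw [Finset.sum_range_succ] at hT'
  have h := hcard.trans hT'
  omega

/-- **Ray-Chaudhuri–Wilson, unconditional form.** For a `k`-uniform family with `|A ∩ B| ∈ L` for
distinct members, `|𝓕| ≤ C(n, s')` where `s' = |{l ∈ L : l < k}|` (intersection sizes of distinct
`k`-sets are `< k`, so only those members of `L` matter). [cite: Jukna2001, Ch. 14 Exercise 14.22;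
RayChaudhuriWilson1975; AlonBabaiSuzuki1991] -/
theorem ray_chaudhuri_wilson_filter [Fintype α] (L : Finset ℕ) (k : ℕ) (𝓕 : Finset (Finset α))
    (hk : ∀ A ∈ 𝓕, A.card = k) (hL : ∀ A ∈ 𝓕, ∀ B ∈ 𝓕, A ≠ B → (A ∩ B).card ∈ L) :
    𝓕.card ≤ (Fintype.card α).choose (L.filter (fun l => l < k)).card := by
  refine ray_chaudhuri_wilson (L.filter (fun l => l < k)) k 𝓕 hk
    (fun l hl => (Finset.mem_filter.mp hl).2) (fun A hA B hB hAB => ?_)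
  refine Finset.mem_filter.mpr ⟨hL A hA B hB hAB, ?_⟩
  -- `|A ∩ B| < k` for distinct `k`-sets
  refine lt_of_le_of_ne ((Finset.card_le_card Finset.inter_subset_left).trans (hk A hA).le) ?_
  intro h
  have hA' : A ∩ B = A := Finset.eq_of_subset_of_card_le Finset.inter_subset_left (by rw [h, hk A hA])
  have hB' : A ∩ B = B := Finset.eq_of_subset_of_card_le Finset.inter_subset_right (by rw [h, hk B hB])
  exact hAB (hA'.symm.trans hB')

end Literature.Combinatorics.SetFamily
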